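import Literature.GroupTheory.CombinatorialGroupTheory.MagnusTruncated
import Literature.GroupTheory.CombinatorialGroupTheory.MagnusResidualNilpotence
import Mathlib.Data.ZMod.Basic
import HarnessLib

/-!
# Free groups are residually {finite nilpotent}

Topic `Literature/GroupTheory/CombinatorialGroupTheory`; theorems only.  For a free group `F(ι)`
(any alphabet) and `w ≠ 1` there is a homomorphism `φ : F(ι) → Q` to a FINITE NILPOTENT group with
`φ w ≠ 1` (`FreeGroup.exists_finite_nilpotent_map_ne_one`; finite alphabets first,
`…_of_finite`, then restriction to the letters of `w`).  This is the qualitative content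
of "free groups are residually finite-`p`" (Lyndon–Schupp, *Combinatorial Group Theory*, Ch. I,
§10, after Prop. 10.2: via the Magnus representation; cf. [SemiAnbd] Remark 1.7.1 = [RZ]
Prop. 3.3.15 for the pro-`l` statement), in the form consumed by [IUTchI] Lemma 2.7 (iii).

Proof.  Take the truncated Magnus representation `ρ_R : F → unipotent R ι n`
(`MagnusTruncated.lean`) at the truncation length `n = |w| + 1` over `R = ℤ/m`.  Reduction of
coefficients and restriction to words of length `< n` is an additive map
`red : ℤ[List ι] → R[W]` intertwining the integral representation of
`MagnusResidualNilpotence.lean` with `ρ_R` (`red_rho_apply`).  By `Magnus.key_coeff` the vector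
`ρ_ℤ(w) e_{[]}` has a non-zero integer coefficient `c` at a non-empty word of length `≤ |w|`;
choosing `m = |c| + 1` this coefficient survives in `ℤ/m`, so `ρ_R(w) ≠ 1`, while the target group
is finite and nilpotent (`MagnusTrunc.finite_unipotent`, `MagnusTrunc.isNilpotent_unipotent`).

## References

* R. C. Lyndon, P. E. Schupp, *Combinatorial Group Theory*, Springer (1977/2001), Ch. I §10,
  Prop. 10.1, 10.2. [LyndonSchupp2001]
-/

noncomputable section

namespace Literature.GroupTheory.CombinatorialGroupTheory

namespace MagnusTrunc

universe u

section Reduction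

variable (R : Type*) [CommRing R] {ι : Type*} [DecidableEq ι] (n : ℕ)

/-- Reduction of coefficients `ℤ → R` and truncation to words of length `< n`:
`red : ℤ[List ι] → R[W]`. [cite: LyndonSchupp2001, Ch. I Prop. 10.1] -/
def red : Magnus.V ι →+ V R ι n :=
  (Finsupp.mapRange.addMonoidHom (Int.castAddHom R)).comp
    (Finsupp.subtypeDomainAddMonoidHom : (List ι →₀ ℤ) →+ (W ι n →₀ ℤ))

omit [DecidableEq ι] in
/-- The coefficients of `red x` are the reduced coefficients of `x`. [cite: LyndonSchupp2001, Ch. I Prop. 10.1] -/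
theorem red_apply (x : Magnus.V ι) (u : W ι n) : red R n x u = ((x u.1 : ℤ) : R) := by
  simp [red, Finsupp.subtypeDomainAddMonoidHom]

/-- `red` on a basis vector. [cite: LyndonSchupp2001, Ch. I Prop. 10.1] -/
theorem red_single (u : List ι) (c : ℤ) :
    red R n (Finsupp.single u c) = if h : u.length < n then Finsupp.single ⟨u, h⟩ (c : R) else 0 := by
  ext v
  rw [red_apply]
  split_ifs with h
  · by_cases hv : (⟨u, h⟩ : W ι n) = v
    · subst hv
      simp
    · have huv : u ≠ v.1 := fun e => hv (Subtype.ext e)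
      rw [Finsupp.single_apply, if_neg huv, Finsupp.single_apply, if_neg hv, Int.cast_zero]
  · rw [Finsupp.single_apply, if_neg (fun e => h (by rw [e]; exact v.2)), Finsupp.zero_apply,
      Int.cast_zero]

/-- `red` intertwines the integral and the `R`-valued truncated shift operators `N_g`.
[cite: LyndonSchupp2001, Ch. I Prop. 10.1] -/
theorem red_shift (g : ι) (x : Magnus.V ι) : red R n (Magnus.shift n g x) = shift R n g (red R n x) := by
  induction x using Finsupp.induction_linear with
  | zero => simp
  | add x y hx hy => simp only [map_add, hx, hy]
  | single u c =>
    rw [Magnus.shift_single, map_zsmul, red_single]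
    unfold Magnus.shiftFun
    by_cases hu : u.length < n
    · rw [dif_pos hu, shift_single]
      unfold shiftFun
      by_cases hc : u.head? ≠ some g ∧ u.length + 1 < n
      · rw [if_pos hc, dif_pos hc, red_single, dif_pos (by simpa using hc.2), Int.cast_one,
          Finsupp.smul_single, Finsupp.smul_single, zsmul_eq_mul, mul_one, smul_eq_mul, mul_one]
      · rw [if_neg hc, dif_neg hc, map_zero, smul_zero, smul_zero]
    · rw [dif_neg hu, map_zero]
      have hc : ¬(u.head? ≠ some g ∧ u.length + 1 < n) := fun h => hu (by omega)
      rw [if_neg hc, map_zero, smul_zero]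

/-- `red` intertwines the integral Magnus representation (on all words) with the truncated one over
`R`. [cite: LyndonSchupp2001, Ch. I Prop. 10.1] -/
theorem red_rho_apply (w : FreeGroup ι) (x : Magnus.V ι) :
    red R n (((Magnus.rho n w : (Module.End ℤ (Magnus.V ι))ˣ) : Module.End ℤ (Magnus.V ι)) x) =
      ((rho R n w : (Module.End R (V R ι n))ˣ) : Module.End R (V R ι n)) (red R n x) := by
  induction w using FreeGroup.induction_on generalizing x with
  | C1 => simp
  | of g =>
    rw [Magnus.rho, FreeGroup.lift_apply_of, rho_of]
    change red R n ((1 + Magnus.shift n g) x) = (1 + shift R n g) (red R n x)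
    rw [LinearMap.add_apply, LinearMap.add_apply, Module.End.one_apply, Module.End.one_apply, map_add,
      red_shift]
  | inv_of g _ =>
    rw [map_inv, map_inv, Magnus.rho, FreeGroup.lift_apply_of, rho_of]
    change red R n ((1 - Magnus.shift n g) x) = (1 - shift R n g) (red R n x)
    rw [LinearMap.sub_apply, LinearMap.sub_apply, Module.End.one_apply, Module.End.one_apply, map_sub,
      red_shift]
  | mul a b ha hb =>
    rw [map_mul, map_mul, Units.val_mul, Units.val_mul, Module.End.mul_apply, Module.End.mul_apply,
      ha, hb]

end Reduction

/-! ## Non-vanishing and the main theorem -/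

/-- **Free groups on a finite alphabet are residually {finite nilpotent}.**  For `w ≠ 1` in
`F(ι)`, `ι` finite, there is a homomorphism to a finite nilpotent group not killing `w` — namely
the truncated Magnus representation over `ℤ/m` for suitable `m`. [cite: LyndonSchupp2001, Ch. I Prop. 10.2] -/
theorem _root_.FreeGroup.exists_finite_nilpotent_map_ne_one_of_finite {ι : Type u} [Finite ι]
    (w : FreeGroup ι) (hw : w ≠ 1) :
    ∃ (Q : Type u) (_ : Group Q) (_ : Finite Q) (_ : Group.IsNilpotent Q) (φ : FreeGroup ι →* Q),
      φ w ≠ 1 := by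
  classical
  set n := w.toWord.length + 1 with hn
  -- the integral leading coefficient
  obtain ⟨key, c, hc, hklen, hhead, hcoef, -⟩ :=
    Magnus.key_coeff n w.toWord.length w.toWord le_rfl (Nat.lt_succ_self _) FreeGroup.isReduced_toWord
  rw [FreeGroup.mk_toWord] at hcoef
  have hkey : key ≠ [] := by
    intro hk
    rw [hk] at hhead
    have hne : w.toWord ≠ [] := fun h' => hw (FreeGroup.toWord_eq_nil_iff.1 h')
    obtain ⟨p, L, hpL⟩ := List.exists_cons_of_ne_nil hne
    rw [hpL] at hhead
    simp at hhead
  have hklt : key.length < n := by omega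
  -- coefficients modulo `m = |c| + 1`
  set m := c.natAbs + 1 with hm
  have hcm : ((c : ℤ) : ZMod m) ≠ 0 := by
    rw [Ne, ZMod.intCast_zmod_eq_zero_iff_dvd]
    intro hdvd
    exact hc (Int.eq_zero_of_dvd_of_natAbs_lt_natAbs hdvd
      (by rw [Int.natAbs_natCast, hm]; exact Nat.lt_succ_self _))
  refine ⟨unipotent (ZMod m) ι n, inferInstance, finite_unipotent, isNilpotent_unipotent,
    rhoU (ZMod m) n, fun h1 => ?_⟩
  have h2 : ((rho (ZMod m) n w : (Module.End (ZMod m) (V (ZMod m) ι n))ˣ) :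
      Module.End (ZMod m) (V (ZMod m) ι n)) = 1 := by
    rw [← coe_rhoU, h1]; rfl
  -- evaluate at the empty word and read off the coefficient at `key`
  have h3 := congrArg (fun v => v ⟨key, hklt⟩)
    (red_rho_apply (ZMod m) n w (Finsupp.single [] 1))
  simp only [h2, Module.End.one_apply, red_apply, hcoef] at h3
  rw [Finsupp.single_apply, if_neg (fun e => hkey e.symm), Int.cast_zero] at h3
  exact hcm h3

/-! ## Arbitrary alphabets: restriction to the letters of `w` -/

/-- The letters of a free group element lie in any set containing the letters of its reduced word:
`mk L ∈ ⟨of a : a a letter of L⟩`. [cite: LyndonSchupp2001, Ch. I Prop. 10.2] -/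
theorem mk_mem_closure_of_letters {ι : Type u} (S : Set ι) :
    ∀ L : List (ι × Bool), (∀ x ∈ L, x.1 ∈ S) →
      FreeGroup.mk L ∈ Subgroup.closure (FreeGroup.of '' S)
  | [], _ => by
    have : FreeGroup.mk ([] : List (ι × Bool)) = 1 := rfl
    rw [this]; exact Subgroup.one_mem _
  | (a, b) :: L, h => by
    have e : FreeGroup.mk ((a, b) :: L) = FreeGroup.mk [(a, b)] * FreeGroup.mk L := by
      rw [FreeGroup.mul_mk]; rfl
    rw [e]
    refine Subgroup.mul_mem _ ?_ (mk_mem_closure_of_letters S L fun x hx => h x (List.mem_cons_of_mem _ hx))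
    have ha : FreeGroup.of a ∈ Subgroup.closure (FreeGroup.of '' S) :=
      Subgroup.subset_closure ⟨a, h (a, b) (by simp), rfl⟩
    cases b
    · have : FreeGroup.mk [(a, false)] = (FreeGroup.of a)⁻¹ := by
        rw [FreeGroup.of, FreeGroup.inv_mk]; rfl
      rw [this]; exact Subgroup.inv_mem _ ha
    · exact ha

/-- **Free groups are residually {finite nilpotent}** (any alphabet): for `w ≠ 1` in `F(ι)` there
is a homomorphism `φ : F(ι) → Q` onto a finite nilpotent group with `φ w ≠ 1`.  Reduction to the
finite alphabet of letters occurring in `w` (the other generators are sent to `1`).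
[cite: LyndonSchupp2001, Ch. I Prop. 10.2] -/
theorem _root_.FreeGroup.exists_finite_nilpotent_map_ne_one {ι : Type u} (w : FreeGroup ι)
    (hw : w ≠ 1) :
    ∃ (Q : Type u) (_ : Group Q) (_ : Finite Q) (_ : Group.IsNilpotent Q) (φ : FreeGroup ι →* Q),
      φ w ≠ 1 := by
  classical
  -- the finite alphabet of `w`
  let S : Finset ι := (w.toWord.map Prod.fst).toFinset
  let ψ : FreeGroup ι →* FreeGroup (S : Set ι) :=
    FreeGroup.lift fun i => if h : i ∈ S then FreeGroup.of ⟨i, h⟩ else 1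
  let back : FreeGroup (S : Set ι) →* FreeGroup ι := FreeGroup.lift fun i => FreeGroup.of (i : ι)
  have hback : ∀ v ∈ Subgroup.closure (FreeGroup.of '' (S : Set ι)), back (ψ v) = v := by
    intro v hv
    induction hv using Subgroup.closure_induction with
    | mem v hv =>
      obtain ⟨i, hi, rfl⟩ := hv
      have hi' : i ∈ S := hi
      simp [ψ, back, hi']
    | one => simp
    | mul a b _ _ ha hb => rw [map_mul, map_mul, ha, hb]
    | inv a _ ha => rw [map_inv, map_inv, ha]
  have hwmem : w ∈ Subgroup.closure (FreeGroup.of '' (S : Set ι)) := by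
    rw [← FreeGroup.mk_toWord (x := w)]
    exact mk_mem_closure_of_letters (S : Set ι) w.toWord fun x hx => by
      simp only [Finset.mem_coe, List.mem_toFinset, List.mem_map, S]
      exact ⟨x, hx, rfl⟩
  have hψw : ψ w ≠ 1 := fun h => hw (by rw [← hback w hwmem, h, map_one])
  obtain ⟨Q, _, _, _, φ, hφ⟩ := FreeGroup.exists_finite_nilpotent_map_ne_one_of_finite (ψ w) hψw
  exact ⟨Q, inferInstance, inferInstance, inferInstance, φ.comp ψ, hφ⟩

end MagnusTrunc

end Literature.GroupTheory.CombinatorialGroupTheory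

end
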